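import Literature.NumberTheory.Automorphic.AutomorphicMeasureGLDomain
import HarnessLib

/-!
# The automorphic measure on `GL_n(𝔸_K) ⧸ (A_G · GL_n(K))` — discharge of
# `AdelicGroupData.exists_isAutomorphicMeasure_gl`

Sibling proof file of `Literature.NumberTheory.Automorphic.AdelicGroupData`: it discharges, sorry-free
and without new named facts, the named fact

* `AdelicGroupData.exists_isAutomorphicMeasure_gl n K` — the automorphic quotient
  `GL_n(𝔸_K) ⧸ (ℝ_{>0} · GL_n(K))` carries a measure `μ` with `IsAutomorphicMeasure μ` (finite,
  positive on non-empty open sets, inner regular, `GL_n(𝔸_K)`-invariant): **Borel–Harish-Chandra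
  finiteness for `GL_n`** (Borel (1963), Thm. 5.8; Godement, Sém. Bourbaki 257, §8; Getz–Hahn
  (2024), Thm. 2.6.2),

as `AdelicGroupData.exists_isAutomorphicMeasure_gl_holds`. The measure is the image of
`μ_Haar|_{F ∩ D}` under the quotient map, where `F` is a Borel fundamental domain for the right action
of the discrete group `GL_n(K)` (`gl_isDiscreteRational_holds`,
`Subgroup.exists_isFundamentalDomain_op_of_discrete`) and `D` is the norm band
(`AutomorphicMeasureGLDomain`). Finiteness is reduction theory plus the finite volume of Siegel sets
(`measure_mul_siegelSet_lt_top`); invariance uses unimodularity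
(`GLn.isMulRightInvariant_of_isHaarMeasure_adelic_holds`), the change of fundamental domain
(`IsFundamentalDomain.measure_set_eq`) and the central elements `z(r) ∈ A_G` to absorb the
determinant; positivity on opens and inner regularity are formal.

## References

* A. Borel, *Some finiteness properties of adele groups over number fields*, Publ. Math. IHÉS 16
  (1963), Thm. 5.8 [Borel1963].
* R. Godement, *Domaines fondamentaux des groupes arithmétiques*, Sém. Bourbaki 257 (1962/63), §8
  [Godement1964].
* J. R. Getz, H. Hahn, *An Introduction to Automorphic Representations*, GTM 300 (2024), Thm. 2.6.2
  and Exercise 3.10 (printed pp. 46, 70) [GetzHahn2024].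
-/

noncomputable section

open MeasureTheory Measure NumberField IsDedekindDomain Matrix Set
open scoped MatrixGroups NNReal ENNReal Pointwise

namespace Literature.NumberTheory.Automorphic

section Construction

variable (n : ℕ) (K : Type) [Field K] [NumberField K]

attribute [local instance] glAdeleBorel borelSpace_glAdele

local notation "𝔸" => AdeleRing (𝓞 K) K

/-- `GL_n(K) ≤ GL_n(𝔸_K)` is countable (`GL_n(K)` is). [folklore] -/
theorem countable_rationalPointsGL : Countable ↥(rationalPointsGL n K) := by
  haveI := countable_generalLinearGroup_numberField n K
  exact (Set.countable_range
    (Matrix.GeneralLinearGroup.map (algebraMap K 𝔸) : GL (Fin n) K → GL (Fin n) 𝔸)).to_subtype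

/-- The quotient map `GL_n(𝔸_K) → GL_n(𝔸_K) ⧸ (A_G · GL_n(K))` is right invariant under `GL_n(K)`.
[folklore] -/
theorem toAutomorphicQuotient_mul_of_mem_rationalPointsGL (x : GL (Fin n) 𝔸) {γ : GL (Fin n) 𝔸}
    (hγ : γ ∈ rationalPointsGL n K) :
    (AdelicGroupData.gl n K).toAutomorphicQuotient (x * γ) =
      (AdelicGroupData.gl n K).toAutomorphicQuotient x :=
  QuotientGroup.mk_mul_of_mem x ((AdelicGroupData.gl n K).arithmeticSubgroup_le_quotientSubgroup hγ)

/-- The quotient map is invariant under positive real scalars (central and in `A_G`):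
`[z x] = [x]`. [folklore] -/
theorem toAutomorphicQuotient_posRealScalar_mul (x : GL (Fin n) 𝔸) (r : ℝ≥0ˣ) :
    (AdelicGroupData.gl n K).toAutomorphicQuotient (posRealScalar n K r * x) =
      (AdelicGroupData.gl n K).toAutomorphicQuotient x := by
  rw [← Subgroup.mem_center_iff.1 (posRealScalar_mem_center n K r) x]
  exact QuotientGroup.mk_mul_of_mem x
    ((AdelicGroupData.gl n K).center'_le_quotientSubgroup ⟨r, rfl⟩)

/-- **Borel–Harish-Chandra finiteness for `GL_n`** — discharge of the named fact
`AdelicGroupData.exists_isAutomorphicMeasure_gl` (Borel (1963), Thm. 5.8; Godement, Sém. Bourbaki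
257, §8; Getz–Hahn (2024), Thm. 2.6.2): the automorphic quotient `GL_n(𝔸_K) ⧸ (ℝ_{>0} · GL_n(K))`
carries a finite, `GL_n(𝔸_K)`-invariant measure which is positive on non-empty open sets and
inner regular.

*Construction.* Let `μ` be a Haar measure on `GL_n(𝔸_K)` (unimodular,
`GLn.isMulRightInvariant_of_isHaarMeasure_adelic_holds`), `F` a Borel fundamental domain for the
right action of the discrete subgroup `GL_n(K)` (`gl_isDiscreteRational_holds`,
`Subgroup.exists_isFundamentalDomain_op_of_discrete`) and `D = {1/2 ≤ |det| ≤ 2}` the norm band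
(`normBand`). The measure is the image of `μ|_{F ∩ D}` under the quotient map.
* *Finite*: by reduction theory `D` is covered by the `GL_n(K)`-translates of the inverse of a
  centrally thickened Siegel set (`normBand_subset_iUnion_smul`), which has finite Haar measure
  (`measure_mul_siegelSet_lt_top`); summing over the translates of `F` gives `μ(F ∩ D) < ∞`.
* *Invariant*: `g (F ∩ D) = z · ((z⁻¹ g) F ∩ D)` for the positive real scalar `z` with
  `|det z| = |det g|` (`smul_normBand_eq`); `z` is central and lies in `A_G`, so it does not move
  the fibres of the quotient map, and `(z⁻¹ g) F` is another fundamental domain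
  (`IsFundamentalDomain.measure_set_eq`).
* *Positive on opens*: a non-empty open set of the quotient has an open preimage meeting
  `{|det| = 1} ⊆ D°`; its `GL_n(K)`-saturation has positive measure, which the translates of `F`
  exhaust.
* *Inner regular*: image of a finite (hence regular) measure under a continuous map.
[cite: Borel1963, Thm. 5.8] -/
theorem AdelicGroupData.exists_isAutomorphicMeasure_gl_holds :
    AdelicGroupData.exists_isAutomorphicMeasure_gl n K := by
  classical
  haveI : T2Space (GL (Fin n) 𝔸) := t2Space_gl n K
  haveI : LocallyCompactSpace (GL (Fin n) 𝔸) :=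
    AdelicGroupData.locallyCompactSpace_generalLinearGroup_adeleRing K (Fin n)
  haveI : SecondCountableTopology (GL (Fin n) 𝔸) :=
    secondCountableTopology_generalLinearGroup_adeleRing K (Fin n)
  -- Haar measure: left and right invariant, inversion invariant
  set μ : Measure (GL (Fin n) 𝔸) := haar with hμ
  haveI : μ.IsMulRightInvariant :=
    GLn.isMulRightInvariant_of_isHaarMeasure_adelic_holds n K μ (inferInstance : μ.IsHaarMeasure)
  haveI : μ.IsInvInvariant := isInvInvariant_of_isMulRightInvariant μ
  -- the discrete countable subgroup `Γ = GL_n(K)` and a fundamental domain for its right action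
  haveI : DiscreteTopology ↥(rationalPointsGL n K) := gl_isDiscreteRational_holds n K
  haveI : Countable ↥(rationalPointsGL n K) := countable_rationalPointsGL n K
  haveI : Countable ↥(rationalPointsGL n K).op :=
    Countable.of_equiv _ (Subgroup.equivOp (rationalPointsGL n K))
  obtain ⟨F, hFm, hF⟩ :=
    Literature.MeasureTheory.Group.Subgroup.exists_isFundamentalDomain_op_of_discrete
      (rationalPointsGL n K) μ
  -- the norm band `D` and the finiteness of `μ (F ∩ D)`
  obtain ⟨Ω, t, Z, ht, hΩc, hΩB, hZc, hZr, hDsub⟩ := normBand_subset_iUnion_smul n K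
  set D : Set (GL (Fin n) 𝔸) := normBand n K with hD
  have hDm : MeasurableSet D := (isClosed_normBand n K).measurableSet
  set R : Set (GL (Fin n) 𝔸) :=
    (Z * (Ω * siegelCone n K t * (standardMaximalCompactGL n K : Set (GL (Fin n) 𝔸))))⁻¹ with hR
  have hRfin : μ R < ⊤ := by
    rw [hR, measure_inv]
    exact measure_mul_siegelSet_lt_top μ hΩc hΩB ht hZc hZr
  have hFD : μ (F ∩ D) < ⊤ := by
    calc μ (F ∩ D) ≤ μ (F ∩ ⋃ γ : ↥(rationalPointsGL n K).op, γ • R) :=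
          measure_mono (inter_subset_inter_right _ hDsub)
      _ = μ (⋃ γ : ↥(rationalPointsGL n K).op, F ∩ γ • R) := by rw [inter_iUnion]
      _ ≤ ∑' γ : ↥(rationalPointsGL n K).op, μ (F ∩ γ • R) := measure_iUnion_le _
      _ = ∑' γ : ↥(rationalPointsGL n K).op, μ (R ∩ γ⁻¹ • F) := by
          congr 1; funext γ
          have hγ : γ⁻¹ • (F ∩ γ • R) = γ⁻¹ • F ∩ R := by
            rw [Set.smul_set_inter, inv_smul_smul]
          rw [← MeasureTheory.measure_smul (μ := μ) (c := γ⁻¹) (s := F ∩ γ • R), hγ, Set.inter_comm]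
      _ = ∑' γ : ↥(rationalPointsGL n K).op, μ (R ∩ γ • F) :=
          (Equiv.inv ↥(rationalPointsGL n K).op).tsum_eq fun γ => μ (R ∩ γ • F)
      _ = μ R := (hF.measure_eq_tsum' R).symm
      _ < ⊤ := hRfin
  -- the quotient map and the candidate measure
  set π : GL (Fin n) 𝔸 → (AdelicGroupData.gl n K).automorphicQuotient :=
    (AdelicGroupData.gl n K).toAutomorphicQuotient with hπ
  have hπc : Continuous π := (AdelicGroupData.gl n K).continuous_toAutomorphicQuotient
  have hπm : Measurable π := hπc.measurable
  set ν : Measure (AdelicGroupData.gl n K).automorphicQuotient :=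
    Measure.map π (μ.restrict (F ∩ D)) with hν
  have hν_apply : ∀ A, MeasurableSet A → ν A = μ (π ⁻¹' A ∩ (F ∩ D)) := fun A hA => by
    rw [hν, Measure.map_apply hπm hA, Measure.restrict_apply (hπm hA)]
  -- invariance of preimages under `Γ` (on the right) and of `D`
  have hinvΓ : ∀ (A : Set (AdelicGroupData.gl n K).automorphicQuotient)
      (γ : ↥(rationalPointsGL n K).op), (fun x => γ • x) ⁻¹' (π ⁻¹' A ∩ D) = π ⁻¹' A ∩ D := by
    intro A γ
    have hγ : MulOpposite.unop (γ : (GL (Fin n) 𝔸)ᵐᵒᵖ) ∈ rationalPointsGL n K :=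
      Subgroup.mem_op.1 γ.2
    ext x
    change (π (x * MulOpposite.unop (γ : (GL (Fin n) 𝔸)ᵐᵒᵖ)) ∈ A ∧
      x * MulOpposite.unop (γ : (GL (Fin n) 𝔸)ᵐᵒᵖ) ∈ D) ↔ (π x ∈ A ∧ x ∈ D)
    rw [hπ, toAutomorphicQuotient_mul_of_mem_rationalPointsGL n K x hγ, hD,
      mul_mem_normBand_iff hγ]
  -- finiteness
  have hfin : IsFiniteMeasure ν := by
    refine ⟨?_⟩
    rw [hν_apply _ MeasurableSet.univ, Set.preimage_univ, Set.univ_inter]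
    exact hFD
  -- invariance under `GL_n(𝔸_K)`
  have hinv : SMulInvariantMeasure (AdelicGroupData.gl n K).Adelic
      (AdelicGroupData.gl n K).automorphicQuotient ν := by
    refine ⟨fun c A hA => ?_⟩
    have hcA : MeasurableSet ((fun y => c • y) ⁻¹' A) := measurable_const_smul c hA
    rw [hν_apply _ hcA, hν_apply _ hA]
    -- view `c` as an element of `GL (Fin n) 𝔸`
    obtain ⟨cG, hcG⟩ : ∃ cG : GL (Fin n) 𝔸, cG = c := ⟨c, rfl⟩
    subst c
    change μ ((fun x : GL (Fin n) 𝔸 => π (cG * x)) ⁻¹' A ∩ (F ∩ D)) = μ (π ⁻¹' A ∩ (F ∩ D))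
    -- the central element of the same absolute determinant
    obtain ⟨r, hr⟩ := exists_glAbsDet_posRealScalar_eq n K cG
    set z : GL (Fin n) 𝔸 := posRealScalar n K r with hz
    have hzπ : ∀ y : GL (Fin n) 𝔸, π (z⁻¹ * y) = π y := fun y => by
      rw [show z⁻¹ = posRealScalar n K r⁻¹ by rw [hz, map_inv]]
      exact toAutomorphicQuotient_posRealScalar_mul n K y r⁻¹
    -- the set identity
    set W : Set (GL (Fin n) 𝔸) := π ⁻¹' A ∩ D with hW
    have hWm : MeasurableSet W := (hπm hA).inter hDm
    have hset : (fun x : GL (Fin n) 𝔸 => π (cG * x)) ⁻¹' A ∩ (F ∩ D) =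
        (fun x => (z⁻¹ * cG) * x) ⁻¹' (W ∩ (z⁻¹ * cG) • F) := by
      have hcD : cG • D = z • D := by rw [hD]; exact smul_normBand_eq hr
      ext x
      simp only [Set.mem_preimage, Set.mem_inter_iff, hW]
      constructor
      · rintro ⟨hxA, hxF, hxD⟩
        refine ⟨⟨?_, ?_⟩, ?_⟩
        · rw [mul_assoc, hzπ]; exact hxA
        · -- `z⁻¹ c x ∈ D ↔ c x ∈ z D = c D ↔ x ∈ D`
          have h2 : cG * x ∈ z • D := by rw [← hcD]; exact Set.smul_mem_smul_set hxD
          rw [mul_assoc]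
          exact Set.mem_smul_set_iff_inv_smul_mem.1 h2
        · exact Set.smul_mem_smul_set hxF
      · rintro ⟨⟨hxA, hxD⟩, hxF⟩
        refine ⟨?_, ?_, ?_⟩
        · rw [mul_assoc, hzπ] at hxA; exact hxA
        · exact (Set.smul_mem_smul_set_iff.1 hxF)
        · have h2 : cG * x ∈ z • D := by
            refine Set.mem_smul_set_iff_inv_smul_mem.2 ?_
            rw [smul_eq_mul, ← mul_assoc]; exact hxD
          rw [← hcD] at h2
          exact Set.smul_mem_smul_set_iff.1 h2
    rw [hset, measure_preimage_mul]
    -- change of fundamental domain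
    have hF' : IsFundamentalDomain (↥(rationalPointsGL n K).op) ((z⁻¹ * cG) • F) μ :=
      hF.smul_of_comm (z⁻¹ * cG)
    rw [hF'.measure_set_eq hF hWm (hinvΓ A), hW, Set.inter_assoc, Set.inter_comm D F]
  -- positivity on non-empty open sets
  have hpos : ν.IsOpenPosMeasure := by
    refine ⟨fun U hU hne => ?_⟩
    rw [hν_apply _ hU.measurableSet]
    obtain ⟨u, hu⟩ := hne
    obtain ⟨x, rfl⟩ := QuotientGroup.mk_surjective u
    obtain ⟨xG, hxG⟩ : ∃ xG : GL (Fin n) 𝔸, xG = x := ⟨x, rfl⟩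
    subst x
    obtain ⟨r, hr⟩ := exists_glAbsDet_mul_posRealScalar_eq_one n K xG
    set x' : GL (Fin n) 𝔸 := xG * posRealScalar n K r with hx'
    have hx'U : π x' ∈ U := by
      have : π x' = π xG := by
        rw [hx', Subgroup.mem_center_iff.1 (posRealScalar_mem_center n K r) xG]
        exact toAutomorphicQuotient_posRealScalar_mul n K xG r
      rw [this]; exact hu
    set O : Set (GL (Fin n) 𝔸) := π ⁻¹' U ∩
      ((fun g => ((glAbsDet n K g : ℝ≥0) : ℝ)) ⁻¹' Set.Ioo (1 / 2) 2) with hO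
    have hOo : IsOpen O :=
      (hU.preimage hπc).inter (isOpen_Ioo.preimage (continuous_glAbsDet_real n K))
    have hx'O : x' ∈ O := by
      refine ⟨hx'U, ?_⟩
      change ((glAbsDet n K x' : ℝ≥0) : ℝ) ∈ Set.Ioo (1 / 2 : ℝ) 2
      rw [hx', hr, Units.val_one, NNReal.coe_one]
      norm_num
    have hOpos : 0 < μ O := hOo.measure_pos μ ⟨x', hx'O⟩
    set W : Set (GL (Fin n) 𝔸) := π ⁻¹' U ∩ D with hW
    have hWm : MeasurableSet W := (hπm hU.measurableSet).inter hDm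
    have hOW : O ⊆ W := fun y hy => ⟨hy.1, ⟨hy.2.1.le, hy.2.2.le⟩⟩
    have hWsum : μ W = ∑' γ : ↥(rationalPointsGL n K).op, μ (W ∩ F) := by
      rw [hF.measure_eq_tsum W]
      congr 1; funext γ
      have hγW : γ • W = W := by
        have h := hinvΓ U γ⁻¹
        rwa [Set.preimage_smul, inv_inv] at h
      rw [hγW]
    intro h0
    have hWF : μ (W ∩ F) = 0 := by rw [hW, Set.inter_assoc, Set.inter_comm D F]; exact h0
    have hW0 : μ W = 0 := by rw [hWsum, hWF, tsum_zero]
    exact (hOpos.trans_le (measure_mono hOW)).ne' hW0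
  -- inner regularity: image of a finite regular measure under a continuous map
  haveI : IsFiniteMeasure (μ.restrict (F ∩ D)) :=
    ⟨by rw [Measure.restrict_apply_univ]; exact hFD⟩
  have hreg : ν.InnerRegularCompactLTTop := by
    rw [hν]
    exact Measure.InnerRegularCompactLTTop.map_of_continuous hπc
  refine ⟨ν, ?_⟩
  haveI := hfin; haveI := hpos; haveI := hreg; haveI := hinv
  constructor

end Construction

end Literature.NumberTheory.Automorphic
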